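import Literature.MathematicalPhysics.QuantumFieldTheory.Balaban1983to89.T4DatumAssembly

/-!
# The DATUM ASSEMBLER, TOWER FORM: a finite-`ε` datum from the RG machine together with an EXPLICIT density tower
# `ρ_k`, `Tρ_k` — the renormalisation transformations read as DATA with the push-forward identity as a displayed obligation —
# and Bałaban's `R` as the density operation INDUCED by the step (sibling of `T4DatumAssembly`; nothing there is edited)

YM-PLAN Track A, node **N23** (binder B1 `hD : D.IsPrintedAveraged`, T4ApexPrinted :135), seat `pub-ymgap-dag-n23-a` — assembler-side
service BY NAME for NODE 00's stage ₉ (chair R437 (1): «₉ = the represented tower; `T4DatumAssembly` is NOT edited — a sibling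
`datumOfRepTower`»; NODE 00's `STAGE6-9-DESIGN-g28.md` §2 and `Record9Skeleton` 63b1f6914ea0fc68: `Trho := eval tT` EXPLICIT, `R` the
density operator INDUCED by the representation-level step, (0.4) from the step's integral identity, NO `rnDeriv` in the realisation).
Bookkeeping ∕ typing only: NOTHING analytic of the series is proved or asserted; no datum of record is claimed or chosen here; one finite
four-torus programme at fixed `ε` — NOT the continuum limit on ℝ⁴, NOT infinite volume, NOT OS, NOT a mass gap, NOT the Clay problem.

## Why a sibling

`T4DatumAssembly.RGMachine.realisation` HARD-WIRES the renormalisation transform of the density tower as the Radon–Nikodym transport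
`Tρ_k := AveragingRT.rnTransport (av K k) ρ_k` (T4DatumAssembly :377) — an `rnDeriv` VERSION, about which only a.e. facts exist.  NODE 00's
stage-₉ design replaces it by the EXPLICIT represented function `Tρ_k := eval (Tstep rep_k)` ([Balaban1988Convergent] (2.18), (2.21), Thm p. 245:
«T of a (2.18)-density is again represented») with the push-forward identity `Setup.IsRT` an a.e. THEOREM of [Balaban1988Convergent] §3 — displayed
until proved — and Bałaban's `R` acting on REPRESENTATIONS ([Balaban1989LargeFieldI] (0.2)–(0.3)), the density-level operation being the induced one.
So a stage-₉ datum cannot be a value of `RGMachine.datum`; but every OTHER field the assembler discharges (the forward-generated flow with its three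
modelling clauses, `Cfg`, `numSites`, the guarded (0.20) leaf, the β-side binders, the END headline from the nodes, binder B1 and the Stage-0 clause
at the averaging of record, the T⁴ apex) does not read the density tower at all.  This module factors the assembler accordingly:

* §1 `RGMachineCore F G` — the machine WITHOUT its large-field operation (the ten construction fields of `RGMachine`; `RGMachine.toCore`
  forgets `R` and its two obligations), and `RGMachineCore.construction M ρ : B16.Construction` over an ARBITRARY density tower
  `ρ : (p : B12.RunParams) → (k : ℕ) → Density (F.P p.K) k G`; every flow-side theorem of `T4DatumAssembly` §2 re-proved verbatim for it
  (`curries`, `forwardGenerated`, `haltsOutside`, `satisfiesRG_construction[_iff]`, `rgFlow_of_smallCouplings`, `rgFlow_of_noOvershoot`,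
  `betaBoundsInInterval_construction`, `endpointExistence_construction`, `endStatementBPrinted_of_nodes_construction[_boxBounds]`) — they read `flow` only;
  `RGMachine.construction av = M.toCore.construction (M.dens av)` (`rfl`): the Stage-5 construction is an instance.
* §2 `RGMachineCore.Tower M av` — AN EXPLICIT DENSITY TOWER ALONG `av`: `ρ p k` and `Trho p k` as honest functions with THREE displayed
  obligations and nothing else: the Wilson start `ρ p 0 = e^{−E(p)}·exp(−A/g₀²)` ([Balaban1988Convergent] Thm 1 p. 262), the push-forward identity
  `IsRT (av K k) (ρ p k) (Trho p k)` for `k < K` ([Balaban1985Averaging] (10); at stage ₉: [Balaban1988Convergent] Thm p. 245 — CONTENT, displayed), and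
  (0.4) AT THE STEP `∫ ρ p (k+1) dV = ∫ Trho p k dV` ([Balaban1989LargeFieldI] (0.4) p. 176).  From these: `Tower.inducedR` — Bałaban's `R` as the
  density operation INDUCED by the step (`Tρ_k ↦ ρ_{k+1}`, identity on every other density — NODE 00's `Rop` pattern), `PreservesIntegral` for EVERY
  density (`preservesIntegral_inducedR`), the `T4Continuum.Realisation` of `M.construction τ.ρ` by `av` with `Trho := τ.Trho` (NO `rnTransport`,
  NO integrability hypothesis anywhere), and the datum `τ.datum : FiniteEpsData F G` (`dens_datum : D.dens K g₀ k = τ.ρ (K, F.m, g₀) k`, `rfl`).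
  `RGMachine.rnTower av hmeas hac` — the Radon–Nikodym tower of `T4DatumAssembly` (`ρ := M.dens av`, `Trho := rnTransport`) IS such a tower, with the
  same construction and densities as `M.datum av hmeas hac` (`rfl`; only the conventional off-tower branch of `real.R` differs).
* §3 at `SU(N)` and NODE 00's averaging of record: `datumOfTower F N M τ`; FOR EVERY core machine AND EVERY tower: the Stage-0 clause
  `Node00.IsDatumOfRecord₀` (`rfl` — the `av` field is `Node00.avOfRecord F N` by construction, the clause the chair's N23 count line R439 names as
  its reversibility test), binder B1 `(datumOfTower F N M τ).IsPrintedAveraged` (node N23 AT STAGE ₉ IN ADVANCE: the refinement «₉ → ₀» on the `av`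
  field is definitional), the ∃-shape the rung item `…BalabanUVNodes.StabilityBAtRecord` quantifies, and the T⁴ apex with B1 eliminated.

What NODE 00's `Record9` then supplies (owner node00-def + def-R + def-B + def-T; names theirs): a `Stage9Params`-indexed `RGMachineCore` (β of
record, `E := Σ log 𝐍_j`, domains, actions, `χ := chi217` products, the clauses with `Sect2Form p k := S218 p k (ρ p k)` read AT the represented
density) and a `Tower` (`ρ p k := eval (rep p k)`, `Trho p k := eval (Tstep (rep p k))`, `rho_zero` = the one-term representation of the Wilson start,
`isRT_Trho` = [III] §3 displayed, `integral_succ` = def-R's (1.100)∕(0.4) identity); `datumOfRepTower θ := datumOfTower F N core tower` — and B1, the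
Stage-0 clause, the flow-side theorems, the END headline and the apex are the theorems below, by name.

## HONEST FRAMING — what this is NOT

* NOT a datum of record, NOT a second datum, NOT stage ₉: `Tower.datum` ∕ `datumOfTower` are FUNCTIONS of (machine core, tower); NODE 00 chooses the
  arguments.  A tower's three obligations are DISPLAYED data exactly like `Residual₅`'s fields (chair R434): a junk tower inhabits the type, so
  nothing typed over `datumOfTower` is closed by this module — it asserts of no tower that it is Bałaban's.
* The off-tower branch of `inducedR` (identity) is a CONVENTION forced by `T4Continuum.Realisation` typing `R` as an operation on all densities with (0.4)
  for all of them; print applies `R` to represented densities only ([Balaban1989LargeFieldI] p. 176 «a density … represented in the form (0.2)»).  Nothing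
  downstream reads the off-tower branch (`FiniteEpsData.integral_dens_*` read `R (Tρ_k)` only).
* No quotation locus is new: every page reference is one certified for `T4Continuum` (v5), `T4DatumAssembly`, `Node00/DatumAvLayer` (cell GAPS C-t4l-1).
  Register: [Balaban1987RG1] = Commun. Math. Phys. 109 (1987) 249–301; [Balaban1988Convergent] = 119 (1988) 243–285; [Balaban1989LargeFieldI] =
  122 (1989) 175–202; [Balaban1989LargeFieldII] = 122 (1989) 355–392; [Balaban1985Averaging] = 98 (1985) 17–51.
-/

noncomputable section

open MeasureTheory

namespace Literature.MathematicalPhysics.QuantumFieldTheory.Balaban1983to89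

namespace T4DatumAssembly

open Missing AveragingRT T4Continuum T4FiniteEpsInhabited FlowStep FlowStepRuns DagBinding

/-! ## 1. The machine without its large-field operation, and the construction over an arbitrary density tower -/

/-- **THE RG MACHINE CORE** — `RGMachine` WITHOUT the density-level large-field operation `R` and its two obligations: the history-dependent
β-functions, the normalisation `E` of the Wilson start, the small-field domains, effective actions, background Wilson actions, expansion terms,
characteristic functions and the three clause predicates, per run and step (the fields `B16.RunData` stores verbatim besides `flow`, `Cfg`,
`numSites`, `ρ`).  At stage ₉ the large-field operation acts on REPRESENTATIONS and the density tower is explicit (`Tower` below), so `R` is no longer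
machine input.  DATA, asserting nothing. [cite: Balaban1988Convergent, (0.2) p.244] -/
structure RGMachineCore (F : T4Family) (G : Type) [GaugeGroup G] [MeasurableSpace G] [HaarData G] where
  /-- the history-dependent β-functions `β_{k+1}(g_0, …, g_k)` -/
  βfun : HBeta
  /-- the normalisation constant `E` of `ρ₀ = exp[−(1/g₀²)A − E]`, per run -/
  E : B12.RunParams → ℝ
  /-- the small-field domains -/
  dom : (p : B12.RunParams) → (k : ℕ) → Set (GaugeField (F.P p.K) k G)
  /-- the effective actions `A_k(g_k, V)` -/
  effAction : (p : B12.RunParams) → (k : ℕ) → GaugeField (F.P p.K) k G → ℝ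
  /-- the Wilson action `A^η(U_k(V))` of the background configuration -/
  wilsonBG : (p : B12.RunParams) → (k : ℕ) → GaugeField (F.P p.K) k G → ℝ
  /-- the expansion term `𝐄_k(U_k(V))` of (0.22)–(0.23) -/
  Ek : (p : B12.RunParams) → (k : ℕ) → GaugeField (F.P p.K) k G → ℝ
  /-- the characteristic functions `χ_k` of (2.17) [III] -/
  χ : (p : B12.RunParams) → (k : ℕ) → GaugeField (F.P p.K) k G → ℝ
  /-- clause: `A_k` is given by (0.22)–(0.24) with (0.29) ([Balaban1987RG1] Thm 1, read at step `k`) -/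
  Repr : B12.RunParams → ℕ → Prop
  /-- clause: `A_k` satisfies the inductive assumptions (1.1)–(1.22) ([Balaban1987RG1] Thm 3, read at step `k`) -/
  IndAss : B12.RunParams → ℕ → Prop
  /-- clause: `ρ_k` has the form (2.18) [III] with the §2 [III] bounds ([Balaban1989LargeFieldII] Thm 1, read at step `k`) -/
  Sect2Form : B12.RunParams → ℕ → Prop

/-- Forgetting the large-field operation: the core of an `RGMachine`. [cite: Balaban1988Convergent, (0.2) p.244 (bookkeeping)] -/
def RGMachine.toCore {F : T4Family} {G : Type} [GaugeGroup G] [MeasurableSpace G] [HaarData G] (M : RGMachine F G) :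
    RGMachineCore F G where
  βfun := M.βfun
  E := M.E
  dom := M.dom
  effAction := M.effAction
  wilsonBG := M.wilsonBG
  Ek := M.Ek
  χ := M.χ
  Repr := M.Repr
  IndAss := M.IndAss
  Sect2Form := M.Sect2Form

namespace RGMachineCore

/-- The core TYPE is inhabited on every family and gauge group (zero β-functions and report fields, clauses `False`); the witness is placeholder content,
deliberately NOT named as a machine. [cite: Balaban1988Convergent, (0.2) p.244 (type-level non-vacuity, bookkeeping)] -/
theorem nonempty {F : T4Family} {G : Type} [GaugeGroup G] [MeasurableSpace G] [HaarData G] : Nonempty (RGMachineCore F G) :=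
  ⟨{ βfun := fun _ _ => 0, E := fun _ => 0, dom := fun _ _ => ∅, effAction := fun _ _ _ => 0, wilsonBG := fun _ _ _ => 0,
     Ek := fun _ _ _ => 0, χ := fun _ _ _ => 0, Repr := fun _ _ => False, IndAss := fun _ _ => False, Sect2Form := fun _ _ => False }⟩

variable {F : T4Family} {G : Type} [GaugeGroup G] [MeasurableSpace G] [HaarData G] (M : RGMachineCore F G)

/-- The Wilson start of the run `p`: `ρ₀ = exp[−(1/g₀²)A(U) − E(p)]` = `e^{−E(p)}` times `Missing.boltzmann` at `β = g₀⁻²`. [cite: Balaban1988Convergent, Thm 1 p.262] -/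
def rhoZero (p : B12.RunParams) : Density (F.P p.K) 0 G :=
  fun U => Real.exp (-M.E p) * boltzmann (F.P p.K) (p.g0⁻¹ ^ 2) U

/-- The Wilson start of an `RGMachine` is its core's (`rfl`). [cite: Balaban1988Convergent, Thm 1 p.262 (bookkeeping)] -/
theorem _root_.Literature.MathematicalPhysics.QuantumFieldTheory.Balaban1983to89.T4DatumAssembly.RGMachine.rhoZero_toCore
    (M : RGMachine F G) (p : B12.RunParams) : M.toCore.rhoZero p = M.rhoZero p := rfl

variable (ρ : (p : B12.RunParams) → (k : ℕ) → Density (F.P p.K) k G)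

/-- **Bałaban's construction ASSEMBLED from the machine core OVER AN ARBITRARY DENSITY TOWER `ρ`** (a `B16.Construction`), per run `p = (K, m, g₀)` on the
`K`-th torus of the family: the coupling flow generated FORWARD from `g₀` by (0.18)∕(0.20) with the core's β-functions (`FlowStepRuns.genFlow`); `Cfg k` = the
gauge fields on `T^{(k)}` ((0.1)); `numSites k = |T₁^{(k)}|`; densities `ρ p`; every other field the core's, verbatim. [cite: Balaban1987RG1, (0.17)–(0.20) pp.255–256] -/
def construction : B16.Construction := fun p =>
  { flow := genFlow M.βfun p.g0
    Cfg := fun k => GaugeField (F.P p.K) k G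
    dom := M.dom p
    effAction := M.effAction p
    wilsonBG := M.wilsonBG p
    Ek := M.Ek p
    numSites := fun k => Fintype.card (Site (F.P p.K) k)
    Repr := M.Repr p
    IndAss := M.IndAss p
    ρ := ρ p
    χ := M.χ p
    Sect2Form := M.Sect2Form p }

/-- The assembled construction's flow IS the forward-generated flow (`rfl`). [cite: Balaban1987RG1, (0.17)–(0.20) pp.255–256 (bookkeeping)] -/
theorem construction_flow (p : B12.RunParams) : (M.construction ρ p).flow = genFlow M.βfun p.g0 := rfl

/-- Its couplings are `FlowStepRuns.genSeq` (`rfl`). [cite: Balaban1987RG1, (0.17)–(0.20) pp.255–256 (bookkeeping)] -/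
theorem construction_g (p : B12.RunParams) : (M.construction ρ p).flow.g = genSeq M.βfun p.g0 := rfl

/-- Its densities are the given tower (`rfl`). [cite: Balaban1988Convergent, (0.2) p.244 (bookkeeping)] -/
theorem construction_ρ (p : B12.RunParams) : (M.construction ρ p).ρ = ρ p := rfl

/-- Its §2-form clause is the core's (`rfl`). [cite: Balaban1989LargeFieldII, Thm 1 p.355 (bookkeeping)] -/
theorem construction_sect2Form (p : B12.RunParams) : (M.construction ρ p).Sect2Form = M.Sect2Form p := rfl

/-- Its small-field part `toB12` does NOT read the density tower (`rfl`). [cite: Balaban1987RG1, Thm 1 p.256 (bookkeeping)] -/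
theorem construction_toB12 (ρ' : (p : B12.RunParams) → (k : ℕ) → Density (F.P p.K) k G) :
    (M.construction ρ).toB12 = (M.construction ρ').toB12 := rfl

/-- **THE STAGE-5 CONSTRUCTION IS AN INSTANCE**: `T4DatumAssembly.RGMachine.construction M av` is the core's construction over the Radon–Nikodym
tower `M.dens av` (`rfl`). [cite: Balaban1988Convergent, (0.2) p.244 (bookkeeping)] -/
theorem _root_.Literature.MathematicalPhysics.QuantumFieldTheory.Balaban1983to89.T4DatumAssembly.RGMachine.construction_eq_toCore
    (M : RGMachine F G) (av : (K j : ℕ) → Averaging (F.P K) j G) : M.construction av = M.toCore.construction (M.dens av) := rfl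

/-- MODELLING CLAUSE 1 (`DagBinding.CurriesHBeta`) for the construction over any tower — definitionally. [cite: Balaban1987RG1, §5 p.298 and (1.22) p.264] -/
theorem curries : CurriesHBeta (M.construction ρ).toB12 M.βfun := fun _ _ _ _ => rfl

/-- MODELLING CLAUSE 2 (`DagBinding.ForwardGenerated`) for the construction over any tower. [cite: Balaban1987RG1, (0.17)–(0.20) pp.255–256] -/
theorem forwardGenerated : ForwardGenerated (M.construction ρ).toB12 M.βfun := by
  refine ⟨fun p => genSeq_zero M.βfun p.g0, fun p k _ _ hrhs => ?_⟩
  show 0 < genSeq M.βfun p.g0 (k + 1) ∧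
    1 / (genSeq M.βfun p.g0 (k + 1)) ^ 2 = 1 / (genSeq M.βfun p.g0 k) ^ 2 - M.βfun k (prefixOf (genSeq M.βfun p.g0) k)
  rw [genSeq_succ]
  exact ⟨solveCoupling_pos hrhs, inv_sq_solveCoupling hrhs⟩

/-- MODELLING CLAUSE 3 (`FlowStepRuns.HaltsOutside`) for the construction over any tower. [cite: Balaban1987RG1, (0.18)–(0.20) pp.255–256 (bookkeeping)] -/
theorem haltsOutside : HaltsOutside (M.construction ρ).toB12 M.βfun := by
  intro p k _ _ hrhs
  show genSeq M.βfun p.g0 (k + 1) ≤ 0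
  rw [genSeq_succ]
  exact solveCoupling_nonpos hrhs

/-- (0.20) holds along every run of the construction that stays in `]0, γ]` (GUARDED leaf, hypothesis-free). [cite: Balaban1987RG1, (0.20) p.256] -/
theorem satisfiesRG_construction (p : B12.RunParams) {γ : ℝ} (hin : (M.construction ρ p).flow.InInterval γ p.K) :
    (M.construction ρ p).flow.SatisfiesRG p.K :=
  FlowStepRuns.satisfiesRG_of_inInterval (M.forwardGenerated ρ) (M.haltsOutside ρ) (M.curries ρ) p hin

/-- (0.20) UNGUARDED along the first `K'` steps of the run `p` ⟺ no overshoot of the β-functions along the generated history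
(`satisfiesRG_genFlow_iff`). [cite: Balaban1987RG1, (0.20) p.256] -/
theorem satisfiesRG_construction_iff (p : B12.RunParams) (K' : ℕ) :
    (M.construction ρ p).flow.SatisfiesRG K' ↔
      ∀ k, k < K' → M.βfun k (prefixOf (genSeq M.βfun p.g0) k) ≤ 1 / (genSeq M.βfun p.g0 k) ^ 2 :=
  RGMachine.satisfiesRG_genFlow_iff M.βfun p.g0 K'

/-- **The GUARDED leaf at a world on the construction**: along an in-interval run of a binding world `w` with `w.C = M.construction ρ`, the carver's run-wise
leaf `rgFlow` ((0.20) for all `k < K`) HOLDS — no input (in-interval forward-generated runs never halt); all `DagBinding.endStatementBPrinted_of_nodesP_interval`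
consumes of that leaf (NODE 00's `Record5.rgFlow_of_smallCouplings`, generic in the tower). [cite: Balaban1987RG1, (0.20) p.256] -/
theorem rgFlow_of_smallCouplings (w : WorldP) (hC : w.C = M.construction ρ) (P : B12.RunParams)
    (hsc : (leavesP w P).smallCouplings) : (leavesP w P).rgFlow := by
  show (w.C P).flow.SatisfiesRG P.K
  have hsc' : (w.C P).flow.InInterval w.γ P.K := hsc
  rw [hC] at hsc' ⊢
  exact M.satisfiesRG_construction ρ P hsc'

/-- The carver's UNGUARDED run-wise leaf `rgFlow` at every run of a binding world on the construction ⟸ the β-functions never overshoot. [cite: Balaban1987RG1, (0.20) p.256] -/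
theorem rgFlow_of_noOvershoot (w : WorldP) (hC : w.C = M.construction ρ)
    (h : ∀ (p : B12.RunParams) (k : ℕ), k < p.K →
      M.βfun k (prefixOf (genSeq M.βfun p.g0) k) ≤ 1 / (genSeq M.βfun p.g0 k) ^ 2)
    (P : B12.RunParams) : (leavesP w P).rgFlow := by
  show (w.C P).flow.SatisfiesRG P.K
  rw [hC]
  exact (M.satisfiesRG_construction_iff ρ P P.K).mpr (h P)

/-- THE β-WINDOW BINDER at the construction from box bounds of the β-functions (`DagBinding.betaBoundsInInterval_of_boxBounds` at `curries`). [cite: Balaban1987RG1, (1.22) p.264] -/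
theorem betaBoundsInInterval_construction {γ₀ b βup : ℝ} (hlo : BetaLowerH b γ₀ M.βfun) (hup : BetaUpperH βup γ₀ M.βfun) :
    BetaBoundsInInterval (M.construction ρ).toB12 γ₀ b βup :=
  betaBoundsInInterval_of_boxBounds _ M.βfun (M.curries ρ) hlo hup

/-- ENDPOINT EXISTENCE (binder B3 = END) at the construction from box properties of the β-functions alone
(`DagBinding.endpointExistence_of_forwardGenerated` at `forwardGenerated`). [cite: Balaban1987RG1, Thm 2 p.259] -/
theorem endpointExistence_construction {γ₀ β' : ℝ} (hγ₀ : 0 < γ₀) (hβ' : 0 ≤ β') (hcont : BetaContH γ₀ M.βfun)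
    (hsign : BetaLowerH 0 γ₀ M.βfun) (hup : BetaUpperH β' γ₀ M.βfun) : EndpointExistence (M.construction ρ).toB12 :=
  endpointExistence_of_forwardGenerated _ M.βfun hγ₀ hβ' hcont hsign hup (M.forwardGenerated ρ)

/-- (B) PINNED at a world on the construction from the thirteen nodes and the β-window — NO (0.20) leaf (`endStatementBPrinted_of_nodesP_guarded` with its
guarded leaf discharged by `satisfiesRG_construction`). [cite: Balaban1989LargeFieldII, Thm 1 p.355 + p.391] -/
theorem endStatementBPrinted_of_nodes_construction (w : WorldP) (hC : w.C = M.construction ρ) (hγ : 0 < w.γ) {γ₀ : ℝ}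
    (hγ₀ : w.γ ≤ γ₀) (hnodes : ∀ P : B12.RunParams, Nodes (leavesP w P))
    (hβ : BetaBoundsInInterval w.C.toB12 γ₀ w.b w.βup) : B16.EndStatementBPrinted w.C := by
  refine endStatementBPrinted_of_nodesP_guarded w hγ hγ₀ hnodes (fun P hsc => ?_) hβ
  change (w.C P).flow.InInterval w.γ P.K at hsc
  show (w.C P).flow.SatisfiesRG P.K
  rw [hC] at hsc ⊢
  exact M.satisfiesRG_construction ρ P hsc

/-- … and with the β-window from box bounds of the β-functions (letters `b = w.b`, `β⁺ = w.βup`). [cite: Balaban1989LargeFieldII, Thm 1 p.355 + p.391] -/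
theorem endStatementBPrinted_of_nodes_construction_boxBounds (w : WorldP) (hC : w.C = M.construction ρ) (hγ : 0 < w.γ) {γ₀ : ℝ}
    (hγ₀ : w.γ ≤ γ₀) (hnodes : ∀ P : B12.RunParams, Nodes (leavesP w P))
    (hlo : BetaLowerH w.b γ₀ M.βfun) (hup : BetaUpperH w.βup γ₀ M.βfun) : B16.EndStatementBPrinted w.C := by
  refine M.endStatementBPrinted_of_nodes_construction ρ w hC hγ hγ₀ hnodes ?_
  rw [hC]
  exact M.betaBoundsInInterval_construction ρ hlo hup

/-! ## 2. Explicit density towers along an averaging family; the induced `R`; the realisation WITHOUT `rnTransport`; the datum -/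

/-- **AN EXPLICIT DENSITY TOWER OF THE CORE `M` ALONG THE AVERAGING FAMILY `av`**: per run `p` and step `k`, the density `ρ p k` on `T^{(k)}` and the
renormalisation transform `Trho p k` of it on `T^{(k+1)}` as honest FUNCTIONS (at stage ₉: the represented densities `eval rep_k` and
`eval (Tstep rep_k)` of [Balaban1988Convergent] (2.18)∕(2.21)), with exactly three DISPLAYED obligations: `ρ₀` is the Wilson start; `Trho p k` IS a
renormalisation transform of `ρ p k` along `av K k` (`Setup.IsRT`, `k < K` — at stage ₉ the content of [Balaban1988Convergent] §3 ∕ Thm p. 245); and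
(0.4) AT THE STEP, `∫ ρ_{k+1} dV = ∫ Tρ_k dV` — all that `T4Continuum.Realisation` reads of Bałaban's `R`.  DATA: a junk tower inhabits the type
(any `ρ`, `Trho` with the obligations assumed); which tower is Bałaban's is NODE 00's stage ₉. [cite: Balaban1988Convergent, (0.2) p.244] -/
structure Tower (av : (K j : ℕ) → Averaging (F.P K) j G) where
  /-- the densities `ρ_k` of the run `p`, as functions on the gauge fields of `T^{(k)}` -/
  ρ : (p : B12.RunParams) → (k : ℕ) → Density (F.P p.K) k G
  /-- the renormalisation transforms `Tρ_k`, as functions on the gauge fields of `T^{(k+1)}` -/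
  Trho : (p : B12.RunParams) → (k : ℕ) → Density (F.P p.K) (k + 1) G
  /-- OBLIGATION: `ρ₀` is the Wilson start `e^{−E(p)}·exp(−A/g₀²)` -/
  rho_zero : ∀ p : B12.RunParams, ρ p 0 = M.rhoZero p
  /-- OBLIGATION: `Tρ_k` IS the renormalisation transform of `ρ_k` along `av K k` (push-forward identity), `k < K` -/
  isRT_Trho : ∀ (p : B12.RunParams) (k : ℕ), k < p.K → IsRT (av p.K k).avg (ρ p k) (Trho p k)
  /-- OBLIGATION (0.4) at the step: `∫ dV ρ_{k+1}(V) = ∫ dV (Tρ_k)(V)`, `k < K` -/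
  integral_succ : ∀ (p : B12.RunParams) (k : ℕ), k < p.K →
    ∫ V, ρ p (k + 1) V ∂fieldMeasure (F.P p.K) (k + 1) G = ∫ V, Trho p k V ∂fieldMeasure (F.P p.K) (k + 1) G

namespace Tower

variable {M} {av : (K j : ℕ) → Averaging (F.P K) j G} (τ : M.Tower av)

/-- **BAŁABAN'S `R` AS THE DENSITY OPERATION INDUCED BY THE STEP**: on the tower's own `Tρ_k` it returns `ρ_{k+1}`; on every other density on `T^{(k+1)}`
it is the identity (conventional branch — print applies `R` to represented densities only).  NO admissibility test against an `rnDeriv` version (NODE 00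
`Record9Skeleton`'s `Rop`, generic in the tower). [cite: Balaban1989LargeFieldI, (0.2)–(0.3) p.176] -/
def inducedR (p : B12.RunParams) (k : ℕ) (σ : Density (F.P p.K) (k + 1) G) : Density (F.P p.K) (k + 1) G :=
  open Classical in if σ = τ.Trho p k then τ.ρ p (k + 1) else σ

/-- `R (Tρ_k) = ρ_{k+1}` — (0.2) `ρ_{k+1} = R T ρ_k` for the induced operation. [cite: Balaban1988Convergent, (0.2) p.244] -/
theorem inducedR_Trho (p : B12.RunParams) (k : ℕ) : τ.inducedR p k (τ.Trho p k) = τ.ρ p (k + 1) := by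
  unfold inducedR
  exact if_pos rfl

/-- Off the tower's `Tρ_k` the induced operation is the identity (the conventional branch). [cite: Balaban1989LargeFieldI, (0.3) p.176 (bookkeeping)] -/
theorem inducedR_of_ne (p : B12.RunParams) (k : ℕ) {σ : Density (F.P p.K) (k + 1) G} (h : σ ≠ τ.Trho p k) :
    τ.inducedR p k σ = σ := by
  unfold inducedR
  exact if_neg h

/-- (0.4) `∫ dV (Rσ)(V) = ∫ dV σ(V)` for the induced operation and EVERY density `σ`, `k < K`: on `Tρ_k` it is the tower's `integral_succ`, elsewhere trivial.
[cite: Balaban1989LargeFieldI, (0.4) p.176] -/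
theorem preservesIntegral_inducedR (p : B12.RunParams) (k : ℕ) (hk : k < p.K) : PreservesIntegral (τ.inducedR p k) := by
  intro σ
  by_cases h : σ = τ.Trho p k
  · rw [h, inducedR_Trho]
    exact τ.integral_succ p k hk
  · rw [τ.inducedR_of_ne p k h]

/-- `ρ₀` of the tower is a positive constant times the Wilson weight. [cite: Balaban1988Convergent, Thm 1 p.262 (bookkeeping)] -/
theorem rho_zero_shape (p : B12.RunParams) :
    ∃ c : ℝ, 0 < c ∧ ∀ U : GaugeField (F.P p.K) 0 G, τ.ρ p 0 U = c * boltzmann (F.P p.K) (p.g0⁻¹ ^ 2) U :=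
  ⟨Real.exp (-M.E p), Real.exp_pos _, fun U => by rw [τ.rho_zero p]; rfl⟩

/-- **THE REALISATION OF THE CONSTRUCTION OVER THE TOWER BY THE AVERAGING FAMILY** (`T4Continuum.Realisation`, all seven fields) WITHOUT `rnTransport` and
without any integrability hypothesis: `cfg` = identity, `ρ₀` = the Wilson start (`rho_zero`), `Trho := τ.Trho` (EXPLICIT), `isRT_Trho` := the tower's
displayed obligation, `R := inducedR` with its (0.4), and `ρ_{k+1} = R(Tρ_k)` by `inducedR_Trho`. [cite: Balaban1988Convergent, (0.2) p.244] -/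
def realisation : Realisation F G (M.construction τ.ρ) av where
  cfg := fun _ _ _ => Equiv.refl _
  rho_zero := fun K g₀ => τ.rho_zero_shape ⟨K, F.m, g₀⟩
  Trho := fun K g₀ k => τ.Trho ⟨K, F.m, g₀⟩ k
  isRT_Trho := fun K g₀ k hk => τ.isRT_Trho ⟨K, F.m, g₀⟩ k hk
  R := fun K g₀ k => τ.inducedR ⟨K, F.m, g₀⟩ k
  preservesIntegral_R := fun K g₀ k hk => τ.preservesIntegral_inducedR ⟨K, F.m, g₀⟩ k hk
  rho_succ_eq := fun K g₀ k _ => by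
    funext V
    exact (congrFun (τ.inducedR_Trho ⟨K, F.m, g₀⟩ k) V).symm

/-- **THE DATUM OF AN EXPLICIT TOWER**: finite-`ε` data on the family `F` with gauge group `G` whose construction is the core's over the tower's densities,
whose β-functions are the core's, whose averaging maps ARE `av` and whose realisation is `realisation` (no `rnDeriv` anywhere).  A FUNCTION of
(core, tower); nothing is chosen here. [cite: Balaban1989LargeFieldII, Thm 1 + (0.1) pp.355–356] -/
def datum : FiniteEpsData F G where
  C := M.construction τ.ρ
  βfun := M.βfun
  curries := M.curries τ.ρ
  fwd := M.forwardGenerated τ.ρ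
  av := av
  real := τ.realisation

/-- Its averaging maps are the given ones (`rfl`). [cite: Balaban1989LargeFieldII, Thm 1 + (0.1) pp.355–356 (bookkeeping)] -/
@[simp] theorem datum_av : τ.datum.av = av := rfl

/-- Its construction is the core's over the tower's densities (`rfl`). [cite: Balaban1989LargeFieldII, Thm 1 + (0.1) pp.355–356 (bookkeeping)] -/
@[simp] theorem datum_C : τ.datum.C = M.construction τ.ρ := rfl

/-- Its β-functions are the core's (`rfl`). [cite: Balaban1987RG1, (1.22) p.264 (bookkeeping)] -/
@[simp] theorem datum_βfun : τ.datum.βfun = M.βfun := rfl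

/-- **Its transported densities `FiniteEpsData.dens` ARE the tower's explicit functions** (`rfl`) — pointwise statements about `ρ_k` ((0.1)∕(2.50) faces)
are statements about `τ.ρ`. [cite: Balaban1988Convergent, (0.2) p.244 (bookkeeping)] -/
theorem dens_datum (K : ℕ) (g₀ : ℝ) (k : ℕ) : τ.datum.dens K g₀ k = τ.ρ ⟨K, F.m, g₀⟩ k := rfl

/-- Its realisation's `Tρ_k` is the tower's explicit `Trho` (`rfl`). [cite: Balaban1988Convergent, (0.2) p.244 (bookkeeping)] -/
theorem trho_datum (K : ℕ) (g₀ : ℝ) (k : ℕ) : τ.datum.real.Trho K g₀ k = τ.Trho ⟨K, F.m, g₀⟩ k := rfl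

/-- The couplings of the datum's run `p` are generated forward from `p.g0` (`rfl`). [cite: Balaban1987RG1, (0.17) p.255 (bookkeeping)] -/
theorem flow_datum (p : B12.RunParams) : (τ.datum.C p).flow = genFlow M.βfun p.g0 := rfl

/-- If `av` IS Bałaban's block averaging (0.4) driven by a small-loop average `ℰ`, the datum is (0.4)-averaged — for every core and tower. [cite: Balaban1987RG1, (0.4) p.253] -/
theorem isBlockAveraged_datum (ℰ : LoopAverage G) (hav : ∀ K j, av K j = BlockAveraging.blockAvg ℰ) : τ.datum.IsBlockAveraged ℰ :=
  fun K j => hav K j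

end Tower

end RGMachineCore

/-! ### The Radon–Nikodym tower of `T4DatumAssembly` is an explicit tower (Stage 5 as an instance) -/

namespace RGMachine

variable {F : T4Family} {G : Type} [GaugeGroup G] [MeasurableSpace G] [HaarData G] [RegularGaugeGroup G]
  (M : RGMachine F G) (av : (K j : ℕ) → Averaging (F.P K) j G)
  (hmeas : ∀ K j, Measurable (av K j).avg) (hac : ∀ K k, k < K → HaarAC (av K k).avg)

/-- **THE RADON–NIKODYM TOWER**: along a measurable averaging family with the Haar bracket, the assembler's density tower `M.dens av` (`ρ_{k+1} = R(Tρ_k)`,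
`T` = `AveragingRT.rnTransport`) with `Trho := rnTransport (av K k) ρ_k` IS an explicit tower of the core `M.toCore`: the push-forward identity by
`T4FiniteEpsInhabited.isRT_rnTransport_of_ac` at `integrable_dens`, (0.4) at the step by the machine's `preservesIntegral_R`. [cite: Balaban1988Convergent, (0.2) p.244] -/
def rnTower : M.toCore.Tower av where
  ρ := M.dens av
  Trho := fun p k => rnTransport (av p.K k).avg (M.dens av p k)
  rho_zero := fun _ => rfl
  isRT_Trho := fun p k hk => isRT_rnTransport_of_ac _ (hmeas p.K k) (hac p.K k hk) _ (M.integrable_dens av hmeas hac p k hk.le)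
  integral_succ := fun p k hk => M.preservesIntegral_R p k hk _

/-- The Radon–Nikodym tower's datum has THE SAME CONSTRUCTION as the assembler's `M.datum av hmeas hac` (`rfl`) — so every world-level statement (`w.C = D.C`,
(B), the window, END) reads identically at both; only the conventional off-tower branch of `real.R` differs (`M.R` there, identity here). [cite: Balaban1989LargeFieldII, Thm 1 + (0.1) pp.355–356 (bookkeeping)] -/
theorem rnTower_datum_C : (M.rnTower av hmeas hac).datum.C = (M.datum av hmeas hac).C := rfl

/-- … the same β-functions (`rfl`). [cite: Balaban1987RG1, (1.22) p.264 (bookkeeping)] -/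
theorem rnTower_datum_βfun : (M.rnTower av hmeas hac).datum.βfun = (M.datum av hmeas hac).βfun := rfl

/-- … the same averaging maps (`rfl`). [cite: Balaban1987RG1, (0.4) p.253 (bookkeeping)] -/
theorem rnTower_datum_av : (M.rnTower av hmeas hac).datum.av = (M.datum av hmeas hac).av := rfl

/-- … the same densities (`rfl`). [cite: Balaban1988Convergent, (0.2) p.244 (bookkeeping)] -/
theorem rnTower_datum_dens (K : ℕ) (g₀ : ℝ) (k : ℕ) :
    (M.rnTower av hmeas hac).datum.dens K g₀ k = (M.datum av hmeas hac).dens K g₀ k := rfl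

/-- … and the same `Tρ_k` (`rfl`). [cite: Balaban1988Convergent, (0.2) p.244 (bookkeeping)] -/
theorem rnTower_datum_trho (K : ℕ) (g₀ : ℝ) (k : ℕ) :
    (M.rnTower av hmeas hac).datum.real.Trho K g₀ k = (M.datum av hmeas hac).real.Trho K g₀ k := rfl

end RGMachine

/-! ## 3. At `SU(N)` and NODE 00's averaging of record: `datumOfTower`, the Stage-0 clause and binder B1 for EVERY core and tower -/

section Record

variable (F : T4Family) (N : ℕ) [NeZero N] (M : RGMachineCore F (Matrix.specialUnitaryGroup (Fin N) ℂ))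
  (τ : M.Tower (Node00.avOfRecord F N))

/-- The core's Wilson start at `SU(N)` is NODE 00's initial density of record `Node00.rhoZeroOfRecord F N K g₀ (E p)` (`rfl`) — the right-hand side of a
record tower's `rho_zero` obligation. [cite: Balaban1988Convergent, Thm 1 p.262 (bookkeeping)] -/
theorem RGMachineCore.rhoZero_eq_rhoZeroOfRecord (p : B12.RunParams) :
    M.rhoZero p = Node00.rhoZeroOfRecord F N p.K p.g0 (M.E p) := rfl

/-- **THE DATUM OF A TOWER AT THE AVERAGING OF RECORD**: the core `M` on `SU(N)` with an explicit density tower `τ` along NODE 00's averaging operations of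
record `Node00.avOfRecord F N` (Bałaban's centred block averaging (0.3)–(0.4) with the inner operation exp[mean log], `Node00/DatumAvLayer`).  A FUNCTION
of (core, tower): NODE 00's stage ₉ `datumOfRepTower` is its value at the core and represented tower OF RECORD, chosen THERE, not here. [cite: Balaban1987RG1, (0.4) p.253] -/
def datumOfTower : FiniteEpsData F (Matrix.specialUnitaryGroup (Fin N) ℂ) :=
  τ.datum

/-- Its averaging maps are the averaging operations of record (`rfl`). [cite: Balaban1987RG1, (0.4) p.253] -/
@[simp] theorem datumOfTower_av : (datumOfTower F N M τ).av = Node00.avOfRecord F N := rfl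

/-- Its construction is the core's over the tower's densities (`rfl`) — the term a binding world of record sets as its `C`. [cite: Balaban1989LargeFieldII, Thm 1 + (0.1) pp.355–356 (bookkeeping)] -/
@[simp] theorem datumOfTower_C : (datumOfTower F N M τ).C = M.construction τ.ρ := rfl

/-- Its β-functions are the core's (`rfl`). [cite: Balaban1987RG1, (1.22) p.264 (bookkeeping)] -/
@[simp] theorem datumOfTower_βfun : (datumOfTower F N M τ).βfun = M.βfun := rfl

/-- **STAGE-0 DATUM CLAUSE, FOR EVERY CORE AND TOWER**: the datum IS a datum of record in the Stage-0 sense `Node00.IsDatumOfRecord₀` (`D.av = avOfRecord F N`,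
definitionally) — the refinement «₉ → ₀» on the `av` field that the chair's N23 count line (R439) names as its reversibility test holds BY CONSTRUCTION for
every tower datum. [cite: Balaban1987RG1, (0.3)–(0.4) p.253] -/
theorem isDatumOfRecord₀_datumOfTower : Node00.IsDatumOfRecord₀ F N (datumOfTower F N M τ) := rfl

/-- BINDER B1 (one-level prescription (0.4)) for every core and tower (`Node00.isPrintedAveraged₁_of_av`). [cite: Balaban1987RG1, (0.4) p.253] -/
theorem isPrintedAveraged₁_datumOfTower : (datumOfTower F N M τ).IsPrintedAveraged₁ :=
  Node00.isPrintedAveraged₁_of_av F N _ rfl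

/-- **BINDER B1 `hD : D.IsPrintedAveraged` (T4ApexPrinted :135) AT THE DATUM OF EVERY CORE AND TOWER** (`Node00.isPrintedAveraged_of_isDatumOfRecord₀`): node
N23 — discharged of record at Stage ₅∕₅C (chair R439) — holds at every stage-₉-shaped datum in advance, hypothesis-free. [cite: Balaban1987RG1, (0.4) p.253] -/
theorem isPrintedAveraged_datumOfTower : (datumOfTower F N M τ).IsPrintedAveraged :=
  Node00.isPrintedAveraged_of_isDatumOfRecord₀ F N _ (isDatumOfRecord₀_datumOfTower F N M τ)

/-- The datum's densities ARE the tower's explicit functions (`rfl`). [cite: Balaban1988Convergent, (0.2) p.244 (bookkeeping)] -/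
theorem dens_datumOfTower (K : ℕ) (g₀ : ℝ) (k : ℕ) : (datumOfTower F N M τ).dens K g₀ k = τ.ρ ⟨K, F.m, g₀⟩ k := rfl

/-- The couplings of the datum's run `p` are generated forward from `p.g0` (`rfl`), so its bare coupling is `p.g0`. [cite: Balaban1987RG1, (0.17) p.255] -/
theorem flow_datumOfTower (p : B12.RunParams) : ((datumOfTower F N M τ).C p).flow = genFlow M.βfun p.g0 := rfl

/-- **THE STAGE-5 DATUM OF RECORD SHAPE IS AN INSTANCE**: at an `RGMachine` on `SU(N)` and its Radon–Nikodym tower along the averaging of record, the tower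
datum has the construction of `T4DatumAssembly.datumOfRecord F N M` (`rfl`). [cite: Balaban1989LargeFieldII, Thm 1 + (0.1) pp.355–356 (bookkeeping)] -/
theorem datumOfTower_rnTower_C (M : RGMachine F (Matrix.specialUnitaryGroup (Fin N) ℂ)) :
    (datumOfTower F N M.toCore
        (M.rnTower (Node00.avOfRecord F N) (Node00.avOfRecord_measurable F N) (Node00.avOfRecord_haarAC F N))).C =
      (datumOfRecord F N M).C := rfl

/-- … and the densities of `T4DatumAssembly.datumOfRecord F N M` (`rfl`). [cite: Balaban1988Convergent, (0.2) p.244 (bookkeeping)] -/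
theorem dens_datumOfTower_rnTower (M : RGMachine F (Matrix.specialUnitaryGroup (Fin N) ℂ)) (K : ℕ) (g₀ : ℝ) (k : ℕ) :
    (datumOfTower F N M.toCore
        (M.rnTower (Node00.avOfRecord F N) (Node00.avOfRecord_measurable F N) (Node00.avOfRecord_haarAC F N))).dens K g₀ k =
      (datumOfRecord F N M).dens K g₀ k := rfl

/-! ### «∃ datum of record» ⟸ «∃ (core, tower)» and the T⁴ apex at a tower datum -/

/-- **(B) PINNED AT A STAGE-0 DATUM OF RECORD, WITH RUNS IN EVERY SMALL WINDOW ⟸ a core and a tower along the averaging of record whose construction has (B)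
and whose forward-generated runs enter every small window** (the body of the rung item `…BalabanUVNodes.StabilityBAtRecord` at `F`, generalised to `SU(N)`;
the stage-₉ form of `T4DatumAssembly.exists_datumOfRecord₀_window_of_machine`). [cite: Balaban1989LargeFieldII, Thm 1 p.355] -/
theorem exists_datumOfRecord₀_window_of_tower
    (h : ∃ (M : RGMachineCore F (Matrix.specialUnitaryGroup (Fin N) ℂ)) (τ : M.Tower (Node00.avOfRecord F N)),
      B16.EndStatementBPrinted (M.construction τ.ρ) ∧
        ∃ γ₁ : ℝ, 0 < γ₁ ∧ ∀ γ : ℝ, 0 < γ → γ ≤ γ₁ →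
          ∃ P : B12.RunParams, (M.construction τ.ρ P).flow.InInterval γ P.K) :
    ∃ D : FiniteEpsData F (Matrix.specialUnitaryGroup (Fin N) ℂ), Node00.IsDatumOfRecord₀ F N D ∧
      B16.EndStatementBPrinted D.C ∧
        ∃ γ₁ : ℝ, 0 < γ₁ ∧ ∀ γ : ℝ, 0 < γ → γ ≤ γ₁ → ∃ P : B12.RunParams, (D.C P).flow.InInterval γ P.K := by
  obtain ⟨M, τ, hB, hw⟩ := h
  exact ⟨datumOfTower F N M τ, isDatumOfRecord₀_datumOfTower F N M τ, hB, hw⟩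

/-- **(B) ∧ END ∧ THE HYBRID-NE7 SPINE UNDER END AT A STAGE-0 DATUM OF RECORD ⟸ a core and tower with the three at the tower datum** (the body of the rung leaf
`…BalabanLadder.UV` at `F`, generalised to `SU(N)`; stage-₉ form of `T4DatumAssembly.exists_datumOfRecord₀_spine_of_machine`). [cite: Balaban1989LargeFieldII, Thm 1 + (0.1) pp.355–356] -/
theorem exists_datumOfRecord₀_spine_of_tower
    (h : ∃ (M : RGMachineCore F (Matrix.specialUnitaryGroup (Fin N) ℂ)) (τ : M.Tower (Node00.avOfRecord F N)),
      B16.EndStatementBPrinted (M.construction τ.ρ) ∧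
        DagBinding.EndpointExistence (M.construction τ.ρ).toB12 ∧
          T4ApexHybrid.HybridNE7Under (datumOfTower F N M τ) (DagBinding.EndpointExistence (M.construction τ.ρ).toB12)) :
    ∃ D : FiniteEpsData F (Matrix.specialUnitaryGroup (Fin N) ℂ), Node00.IsDatumOfRecord₀ F N D ∧
      B16.EndStatementBPrinted D.C ∧ DagBinding.EndpointExistence D.C.toB12 ∧
        T4ApexHybrid.HybridNE7Under D (DagBinding.EndpointExistence D.C.toB12) := by
  obtain ⟨M, τ, hB, hE, hNE⟩ := h
  exact ⟨datumOfTower F N M τ, isDatumOfRecord₀_datumOfTower F N M τ, hB, hE, hNE⟩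

/-- **THE T⁴ APEX AT A TOWER DATUM** (kernel): (B), endpoint existence and the hybrid-NE7 spine under END at `datumOfTower F N M τ` give
`ContinuumYM4Torus (datumOfTower F N M τ)` — binder B1 supplied by `isPrintedAveraged_datumOfTower`, the other three as hypotheses
(`T4ContinuumYM4Torus.continuumYM4_torus_of_endpointExistence`). [cite: JaffeWittenClay2006, §6.5 p.11] -/
theorem continuumYM4Torus_datumOfTower
    (hB : B16.EndStatementBPrinted (datumOfTower F N M τ).C)
    (hE : DagBinding.EndpointExistence (datumOfTower F N M τ).C.toB12)
    (hNE : T4ApexHybrid.HybridNE7Under (datumOfTower F N M τ) (DagBinding.EndpointExistence (datumOfTower F N M τ).C.toB12)) :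
    T4ContinuumYM4Torus.ContinuumYM4Torus (datumOfTower F N M τ) :=
  T4ContinuumYM4Torus.continuumYM4_torus_of_endpointExistence _ (isPrintedAveraged_datumOfTower F N M τ) hB hE hNE

end Record

end T4DatumAssembly

end Literature.MathematicalPhysics.QuantumFieldTheory.Balaban1983to89

end
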